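import Summits.AtomisticToContinuum.Crystallization.Theorems.FrustratedLawDichotomyStrainedPatchGradedStage

/-!
# Strained patch — SHELL SPLIT: the far column with the host EXTERIOR-ANNULUS constant moved to the cluster side
# (decomp-a2c lens-5, generation 80; crux `AperiodicFrustratedLawGap`, stmt-AtomisticToContinuum-27623; critic rows 1284 / 1285 / 1287 (2) — the OCX8 format delta)

THE FORMAT DELTA.  In the far split of record (`…StrainedPatchFarSplit`, (HFAR) `HostFarTab` + (XTAIL) `ExtTail` ⇐ (TAILCERT) `TailCert`) a host move-test
partner `k₀` of row `h` that is NOT an image of the chart (in particular every host site in the exterior annulus beyond `63/10 + τ`) is charged on the HOST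
side at `‖bondForce (z₀ k₀ − z₀ h) − pairHess … (D h)‖` («partner may be absent», inside `hostFarH`), while the cluster's actual partners outside the
charted ball are charged AGAIN on the CLUSTER side (`extUncharted`, bounded by hard-core packing).  The census's outer-coarse-chart columns (OC / OCX)
instead charge such a partner ONCE, by the displacement of an actual cluster partner from the host point.  No typed hypothesis of the T-leaf supplies the
exterior presence that OC / OCX presuppose; what the record's own currency DOES allow is to move, for any host-decidable EXTERIOR SELECTOR `S`
(which exterior host partners `k₀` of row `h` — all beyond `63/10 + τ`, hence never occupied by an admissible reading — the exterior chart declares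
«present and matched»), the host constant `shellConst τ S z₀ c₀ h = Σ_{k₀ ∈ shellNbrs τ S z₀ c₀ h} bondForce (z₀ k₀ − z₀ h)` from the host side to the
cluster side: `farResid = [extCharted − (hostFar − C) − colFar] + [extUncharted − C]`, `C = shellConst τ S z₀ c₀ (e a)`.

§1 selectors (`ShellSel`, `annulusSel w`, `emptySel`), the selected partner set and the shell constant (`shellNbrs`, `shellConst`; empty / zero for `emptySel`
and for `annulusSel w` with `w ≤ τ`);
§2 the two tables: (HFAR-S) `HostFarTabS 𝓘 τ r S Xh` [INSTRUMENTABLE · per host, the SAME admissible host reading as (HFAR): `‖hostExt‖ + ‖hostFarH − shellConst‖ +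
‖colFarH‖ ≤ Xh`] and (XTAIL-S) `ShellTail 𝓘 τ S Xe` [cluster-quantified, the binders of (XTAIL): `‖extUncharted − shellConst (e a)‖ ≤ Xe`];
§3 SOUNDNESS `farColumn_of_shellTabs : r + 2τ ≤ 7 → 0 ≤ τ → HostFarTabS → ShellTail → FarColumn 𝓘 τ r (Xh + Xe)` — the SAME (FAR) binder the junctions of
record consume — and the uniform T-leaf record `coreOff_of_envelope_shellTabs`;
§4 RECOVERIES: a selector with vanishing shell constant gives (HFAR) ⇔ (HFAR-S) and (XTAIL) ⇒ (XTAIL-S) (the record of `…TailPacking` is the EMPTY selector);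
for every selector the packing discharge survives with the selected constant added in norm (`shellTail_of_extTail_add`), so (XTAIL-S) is never harder to
certify than (XTAIL);
§6 the same records in GRADED table currency (`tubeFloorG_of_envelope_shellTabs_pairTabsG`, `coreOff_of_envelope_shellTabs_pairTabsG`,
`coreOff_record_of_gradeTol_shellTabs` — LITERALLY g78's `coreOff_record_of_gradeTol_pairTabs` with (HFAR, TAILCERT) replaced by (HFAR-S, XTAIL-S));
§5 the typed ENTRY POINT of an exterior chart: (SHELL-MATCH) `ShellMatch 𝓘 τ w R₁` — a two-radius chart (the `τ`-chart on the `63/10`-ball extended to the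
cluster annulus `(63/10, 63/10 + w]`, each annulus site read within the host-side MATCHING-RADIUS TABLE `R₁` at its image, injective, covering the host annulus
up to `63/10 + w − R₁ − τ`); monotone in `R₁`.  Its soundness table (SHELL-CERT ⇒ (XTAIL-S)) and the first-annulus matching lemma (`w ≤ d₀/4`,
`R₁ = (1 + κ)·d₀⁺/8 + (1 + 2κ)τ`, `κ ∈ {1, 2, 3}` the host-computable transfer index; pre-registered in memo NODE-g80 §5) are generation 81's items; at
`(w, R₁) = (7, d₀/8)` it is the hypothesis under which the census column OCX8 is a (XTAIL-S) column.
No `sorry`, no new axioms, zero edits to landed declarations.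
-/

namespace Summit.AtomisticToContinuum.Crystallization.Theorems.FrustratedLawDichotomyStrainedPatchShellSplit

open scoped BigOperators Classical RealInnerProductSpace
open Set
open Summit.AtomisticToContinuum.Crystallization.Theorems.FrustratedLawDichotomyMotifLemmas
open Summit.AtomisticToContinuum.Crystallization.Theorems.FrustratedLawDichotomyAveragingCut
open Summit.AtomisticToContinuum.Crystallization.Theorems.FrustratedLawDichotomyStrainedPatchHomSplit
open Summit.AtomisticToContinuum.Crystallization.Theorems.FrustratedLawDichotomyStrainedPatchCleanCollar
open Summit.AtomisticToContinuum.Crystallization.Theorems.FrustratedLawDichotomyStrainedPatchPhaseCut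
open Summit.AtomisticToContinuum.Crystallization.Theorems.FrustratedLawDichotomyStrainedPatchCoreTube
open Summit.AtomisticToContinuum.Crystallization.Theorems.FrustratedLawDichotomyStrainedPatchStrainBands
open Summit.AtomisticToContinuum.Crystallization.Theorems.FrustratedLawDichotomyStrainedPatchHomIsometry
open Summit.AtomisticToContinuum.Crystallization.Theorems.FrustratedLawDichotomyStrainedPatchHomTubeIso
open Summit.AtomisticToContinuum.Crystallization.Theorems.FrustratedLawDichotomyStrainedPatchEnvelopeLaw
open Summit.AtomisticToContinuum.Crystallization.Theorems.FrustratedLawDichotomyStrainedPatchEnvelopeTaylor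
open Summit.AtomisticToContinuum.Crystallization.Theorems.FrustratedLawDichotomyStrainedPatchChartFamilies
open Summit.AtomisticToContinuum.Crystallization.Theorems.FrustratedLawDichotomyStrainedPatchChartFamiliesPinned
open Summit.AtomisticToContinuum.Crystallization.Theorems.FrustratedLawDichotomyStrainedPatchQuantSlaving
open Summit.AtomisticToContinuum.Crystallization.Theorems.FrustratedLawDichotomyStrainedPatchHostCells
open Summit.AtomisticToContinuum.Crystallization.Theorems.FrustratedLawDichotomyStrainedPatchForceCap
open Summit.AtomisticToContinuum.Crystallization.Theorems.FrustratedLawDichotomyStrainedPatchTextureFloor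
open Summit.AtomisticToContinuum.Crystallization.Theorems.FrustratedLawDichotomyStrainedPatchSVCharge
open Summit.AtomisticToContinuum.Crystallization.Theorems.FrustratedLawDichotomyStrainedPatchChargePrice
open Summit.AtomisticToContinuum.Crystallization.Theorems.FrustratedLawDichotomyStrainedPatchTaylorTop
open Summit.AtomisticToContinuum.Crystallization.Theorems.FrustratedLawDichotomyStrainedPatchTaylorCharge
open Summit.AtomisticToContinuum.Crystallization.Theorems.FrustratedLawDichotomyStrainedPatchHostStep
open Summit.AtomisticToContinuum.Crystallization.Theorems.FrustratedLawDichotomyStrainedPatchBondCalculus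
open Summit.AtomisticToContinuum.Crystallization.Theorems.FrustratedLawDichotomyStrainedPatchFarSplit
open Summit.AtomisticToContinuum.Crystallization.Theorems.FrustratedLawDichotomyStrainedPatchTailPacking
open Summit.AtomisticToContinuum.Crystallization.Theorems.FrustratedLawDichotomyStrainedPatchRimFold
open Summit.AtomisticToContinuum.Crystallization.Theorems.FrustratedLawDichotomyStrainedPatchRowPrice
open Summit.AtomisticToContinuum.Crystallization.Theorems.FrustratedLawDichotomyStrainedPatchGradStep
open Summit.AtomisticToContinuum.Crystallization.Theorems.FrustratedLawDichotomyStrainedPatchGradedTube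
open Summit.AtomisticToContinuum.Crystallization.Theorems.FrustratedLawDichotomyStrainedPatchGradedDescent
open Summit.AtomisticToContinuum.Crystallization.Theorems.FrustratedLawDichotomyStrainedPatchGradedStage

/-! ## §1. Exterior selectors, the selected host exterior partners of a row, and the shell constant -/

/-- A host-side EXTERIOR SELECTOR: for an instance `(M₀, z₀, c₀)`, a row `h` and a host site `k₀`, whether the exterior partner `k₀` of `h` is moved to the
cluster side (declared «present and matched» by the census's exterior chart).  Decidable real arithmetic per host in every intended instance
(`annulusSel w`, distance windows, per-pair lists). -/
abbrev ShellSel : Type := (M₀ : ℕ) → (Fin M₀ → E3) → Fin M₀ → Fin M₀ → Fin M₀ → Prop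

/-- The ANNULUS selector of width `w`: exterior partners with centre distance `≤ 63/10 + w`. -/
def annulusSel (w : ℝ) : ShellSel := fun _ z₀ c₀ _ k₀ => dist (z₀ k₀) (z₀ c₀) ≤ 63 / 10 + w

/-- The EMPTY selector (nothing moved: the far split of record). -/
def emptySel : ShellSel := fun _ _ _ _ _ => False

/-- The SELECTED host exterior move-test partners of row `h`: host sites `k₀ ≠ h` within the move radius `7` of `h`, beyond every admissible occupancy
(`63/10 + τ < dist (z₀ k₀) (z₀ c₀)`; `HostReading` confines occupancies to `63/10 + τ`), and selected by `S`. -/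
noncomputable def shellNbrs (τ : ℝ) (S : ShellSel) {M₀ : ℕ} (z₀ : Fin M₀ → E3) (c₀ h : Fin M₀) : Finset (Fin M₀) :=
  (moveNbrs 7 z₀ h).filter (fun k₀ => 63 / 10 + τ < dist (z₀ k₀) (z₀ c₀) ∧ S M₀ z₀ c₀ h k₀)

/-- The SHELL CONSTANT of row `h`: the host bond forces from its selected exterior partners (their «partner absent» constants). -/
noncomputable def shellConst (τ : ℝ) (S : ShellSel) {M₀ : ℕ} (z₀ : Fin M₀ → E3) (c₀ h : Fin M₀) : E3 :=
  ∑ k₀ ∈ shellNbrs τ S z₀ c₀ h, bondForce (z₀ k₀ - z₀ h)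

/-- Membership in the selected exterior partner set. [formal bookkeeping] -/
theorem mem_shellNbrs {τ : ℝ} {S : ShellSel} {M₀ : ℕ} {z₀ : Fin M₀ → E3} {c₀ h k₀ : Fin M₀} :
    k₀ ∈ shellNbrs τ S z₀ c₀ h ↔ k₀ ≠ h ∧ dist (z₀ k₀) (z₀ h) ≤ 7 ∧ 63 / 10 + τ < dist (z₀ k₀) (z₀ c₀) ∧ S M₀ z₀ c₀ h k₀ := by
  rw [shellNbrs, Finset.mem_filter, mem_moveNbrs_iff, and_assoc]

/-- The empty selector selects nothing. [formal bookkeeping] -/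
theorem shellNbrs_emptySel (τ : ℝ) {M₀ : ℕ} (z₀ : Fin M₀ → E3) (c₀ h : Fin M₀) : shellNbrs τ emptySel z₀ c₀ h = ∅ :=
  Finset.eq_empty_of_forall_notMem fun _ hk => (mem_shellNbrs.1 hk).2.2.2

/-- For `w ≤ τ` the annulus selector selects nothing. [formal bookkeeping] -/
theorem shellNbrs_annulusSel_of_le {τ w : ℝ} (hw : w ≤ τ) {M₀ : ℕ} (z₀ : Fin M₀ → E3) (c₀ h : Fin M₀) : shellNbrs τ (annulusSel w) z₀ c₀ h = ∅ := by
  refine Finset.eq_empty_of_forall_notMem fun k₀ hk => ?_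
  obtain ⟨-, -, h1, h2⟩ := mem_shellNbrs.1 hk
  simp only [annulusSel] at h2
  linarith

/-- The shell constant of the empty selector vanishes. [formal bookkeeping] -/
theorem shellConst_emptySel (τ : ℝ) {M₀ : ℕ} (z₀ : Fin M₀ → E3) (c₀ h : Fin M₀) : shellConst τ emptySel z₀ c₀ h = 0 := by
  rw [shellConst, shellNbrs_emptySel, Finset.sum_empty]

/-- For `w ≤ τ` the annulus shell constant vanishes. [formal bookkeeping] -/
theorem shellConst_annulusSel_of_le {τ w : ℝ} (hw : w ≤ τ) {M₀ : ℕ} (z₀ : Fin M₀ → E3) (c₀ h : Fin M₀) : shellConst τ (annulusSel w) z₀ c₀ h = 0 := by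
  rw [shellConst, shellNbrs_annulusSel_of_le hw, Finset.sum_empty]

/-- The shell constant is at most the sum of the selected bond-force magnitudes `|V′(dist)|`. [formal bookkeeping] -/
theorem norm_shellConst_le {τ : ℝ} {S : ShellSel} {M₀ : ℕ} (z₀ : Fin M₀ → E3) (c₀ h : Fin M₀) :
    ‖shellConst τ S z₀ c₀ h‖ ≤ ∑ k₀ ∈ shellNbrs τ S z₀ c₀ h, |ljD1 (dist (z₀ k₀) (z₀ h))| :=
  (norm_sum_le _ _).trans (le_of_eq (Finset.sum_congr rfl fun k₀ _ => by rw [norm_bondForce, dist_eq_norm]))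

/-- A selected exterior partner is NOT in an admissible occupancy. [formal bookkeeping: `HostReading` confines the occupancy to `63/10 + τ`] -/
theorem not_mem_occ_of_mem_shellNbrs {τ : ℝ} {S : ShellSel} {M₀ : ℕ} {z₀ : Fin M₀ → E3} {c₀ h k₀ : Fin M₀} {O : Finset (Fin M₀)} {D : Fin M₀ → E3}
    (hR : HostReading τ z₀ c₀ O D) (hk : k₀ ∈ shellNbrs τ S z₀ c₀ h) : k₀ ∉ O := fun hO => by
  have h1 := hR.2.2.1 k₀ hO
  have h2 := (mem_shellNbrs.1 hk).2.2.1
  linarith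

/-! ## §2. The two tables of the shell split -/

/-- ★ **(HFAR-S) `HostFarTabS 𝓘 τ r S Xh`** [INSTRUMENTABLE · finite-dimensional per host cell — the same admissible host reading as (HFAR)]: on every instance,
every admissible host reading and every maybe-reach row, `‖hostExt‖ + ‖hostFarH − shellConst‖ + ‖colFarH‖ ≤ Xh(z₀)(h)` — the «partner absent» constants of the
SELECTED exterior partners are REMOVED from the host side (their diagonal `pairHess … (D h)` terms stay). -/
def HostFarTabS (𝓘 : ChartFam) (τ r : ℝ) (S : ShellSel) (Xh : SlackTab) : Prop :=
  ∀ (M₀ : ℕ) (z₀ : Fin M₀ → E3) (c₀ : Fin M₀), 𝓘 M₀ z₀ c₀ → ∀ (O : Finset (Fin M₀)) (D : Fin M₀ → E3), HostReading τ z₀ c₀ O D →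
    ∀ h ∈ O, HostMaybeReach τ z₀ c₀ O h →
      ‖hostExt r z₀ O D h‖ + ‖hostFarH r z₀ O D h - shellConst τ S z₀ c₀ h‖ + ‖colFarH r z₀ c₀ O D h‖ ≤ Xh M₀ z₀ c₀ h

/-- ★ **(XTAIL-S) `ShellTail 𝓘 τ S Xe`** [cluster-quantified — the binders of (XTAIL) `ExtTail`]: on every admissible clean mono-phase `𝓘`-charted cluster, for
every reach row `a`, the un-charted exterior force MINUS the host shell constant of its image row is `≤ Xe(z₀)(e a)`.  This is the slot an exterior chart
(first shell present within `r₁` of the host annulus points) certifies with a DISPLACEMENT charge instead of «absent + phantom». -/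
def ShellTail (𝓘 : ChartFam) (τ : ℝ) (S : ShellSel) (Xe : SlackTab) : Prop :=
  ∀ (M : ℕ) (z : Fin M → E3) (c : Fin M) (M₀ : ℕ) (z₀ : Fin M₀ → E3) (c₀ : Fin M₀) (e : Fin M → Fin M₀) (t : ℝ),
    Admissible M z c → CleanBall (63 / 10) z c → MonoPhaseBall (63 / 10) z c → 0 ≤ t → t ≤ constLaw τ M₀ z₀ c₀ → ChartBy 𝓘 τ t z c z₀ c₀ e →
      FineChart τ z c z₀ c₀ e → ∀ a ∈ ball (63 / 10) z c, IsReach z c a → ‖extUncharted z c a - shellConst τ S z₀ c₀ (e a)‖ ≤ Xe M₀ z₀ c₀ (e a)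

/-- (HFAR-S) is monotone in the column. [formal bookkeeping] -/
theorem hostFarTabS_mono {𝓘 : ChartFam} {τ r : ℝ} {S : ShellSel} {X Y : SlackTab} (hXY : ∀ (M₀ : ℕ) (z₀ : Fin M₀ → E3) (c₀ h : Fin M₀), X M₀ z₀ c₀ h ≤ Y M₀ z₀ c₀ h)
    (hX : HostFarTabS 𝓘 τ r S X) : HostFarTabS 𝓘 τ r S Y :=
  fun M₀ z₀ c₀ hI O D hR h hh hm => (hX M₀ z₀ c₀ hI O D hR h hh hm).trans (hXY M₀ z₀ c₀ h)

/-- (XTAIL-S) is monotone in the column. [formal bookkeeping] -/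
theorem shellTail_mono {𝓘 : ChartFam} {τ : ℝ} {S : ShellSel} {X Y : SlackTab} (hXY : ∀ (M₀ : ℕ) (z₀ : Fin M₀ → E3) (c₀ h : Fin M₀), X M₀ z₀ c₀ h ≤ Y M₀ z₀ c₀ h)
    (hX : ShellTail 𝓘 τ S X) : ShellTail 𝓘 τ S Y :=
  fun M z c M₀ z₀ c₀ e t hz hcl hm ht htT hch hf a ha hr => (hX M z c M₀ z₀ c₀ e t hz hcl hm ht htT hch hf a ha hr).trans (hXY M₀ z₀ c₀ (e a))

/-! ## §3. SOUNDNESS: (HFAR-S) + (XTAIL-S) ⟹ (FAR); the uniform record -/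

/-- The regrouping identity behind the shell split. [formal bookkeeping] -/
theorem farPieces_regroup (A U H C S : E3) : A + U - H - C = (A - (H - S) - C) + (U - S) := by abel

/-- ★★★ **`farColumn_of_shellTabs`** — (HFAR-S Xh) ∧ (XTAIL-S Xe) ∧ `r + 2τ ≤ 7` ⟹ `FarColumn 𝓘 τ r (Xh + Xe)`: the far residual of a reach row is
`[extCharted − (hostFar − S) − colFar] + [extUncharted − S]` with `S` the shell constant of the image row; the first bracket reads on the host at the chart's
admissible reading `(occ, disp)` (`extCharted_eq_hostExt`, `hostFar_eq_hostFarH`, `colFar_eq_colFarH`), the second is (XTAIL-S).  The conclusion is the SAME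
(FAR) binder `FarColumn` that `coreOff_of_envelope_hostTables` (uniform) and `tubeFloorG_of_hostTabsG` (graded) consume. [formal bookkeeping] -/
theorem farColumn_of_shellTabs {𝓘 : ChartFam} {τ r : ℝ} {S : ShellSel} {Xh Xe : SlackTab} (hr : r + 2 * τ ≤ 7) (hτ : 0 ≤ τ)
    (hH : HostFarTabS 𝓘 τ r S Xh) (hE : ShellTail 𝓘 τ S Xe) : FarColumn 𝓘 τ r (fun M₀ z₀ c₀ h => Xh M₀ z₀ c₀ h + Xe M₀ z₀ c₀ h) := by
  intro M z c M₀ z₀ c₀ e t hz hcl hm ht htT hch hf a ha hrch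
  have hinj : ∀ b b', b ∈ ball (63 / 10) z c → b' ∈ ball (63 / 10) z c → e b = e b' → b = b' := fun b b' hb hb' hE' =>
    hch.2.2.2.2.1 b b' (mem_ball.1 hb) (mem_ball.1 hb') hE'
  have h1 := hH M₀ z₀ c₀ hch.1 _ _ (hostReading_of_chart hch hf) (e a) (mem_occ_of_mem ha) (hostMaybeReach_of_isReach hf ha hrch)
  have h2 := hE M z c M₀ z₀ c₀ e t hz hcl hm ht htT hch hf a ha hrch
  rw [← extCharted_eq_hostExt r hinj ha, ← hostFar_eq_hostFarH r hinj ha, ← colFar_eq_colFarH r hinj ha] at h1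
  rw [farResid_eq hinj ha (by linarith) fun b hb => dist_le_seven_of_mem_nearSet hr hf ha hb, exteriorForce_eq_add,
    farPieces_regroup _ _ _ _ (shellConst τ S z₀ c₀ (e a))]
  calc ‖extCharted r z c z₀ e a - (hostFar r z c z₀ c₀ e a - shellConst τ S z₀ c₀ (e a)) - colFar r z c z₀ c₀ e a +
          (extUncharted z c a - shellConst τ S z₀ c₀ (e a))‖
      ≤ ‖extCharted r z c z₀ e a - (hostFar r z c z₀ c₀ e a - shellConst τ S z₀ c₀ (e a)) - colFar r z c z₀ c₀ e a‖ +
          ‖extUncharted z c a - shellConst τ S z₀ c₀ (e a)‖ := norm_add_le _ _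
    _ ≤ (‖extCharted r z c z₀ e a‖ + ‖hostFar r z c z₀ c₀ e a - shellConst τ S z₀ c₀ (e a)‖ + ‖colFar r z c z₀ c₀ e a‖) +
          ‖extUncharted z c a - shellConst τ S z₀ c₀ (e a)‖ := by
        gcongr
        exact (norm_sub_le _ _).trans (by gcongr; exact norm_sub_le _ _)
    _ ≤ Xh M₀ z₀ c₀ (e a) + Xe M₀ z₀ c₀ (e a) := by linarith

/-- ★★★ **THE T-LEAF RECORD WITH THE SHELL SPLIT (uniform currency)** — `[CORE-FAR]` from: the cover, `2τ < s₀`, host separation, `r + 2τ ≤ 7`, the per-host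
table (HFAR-S), the shell tail (XTAIL-S), a dominating slack column `X ≥ Xh + Xe`, the host top and steps with the closed-form γ-envelope tail, and the terminal
certificate — LITERALLY the hypotheses of `coreOff_of_envelope_tailCert` with (HFAR, TAILCERT) replaced by (HFAR-S, XTAIL-S).
[formal bookkeeping: `coreOff_of_envelope_hostTables` + `farColumn_of_shellTabs` + `farColumn_mono`] -/
theorem coreOff_of_envelope_shellTabs {𝓘 : ChartFam} {τ s₀ r : ℝ} {S : ShellSel} {X Xh Xe : SlackTab} (k : ℕ → ℝ) (n : ℕ) (hτ : 0 ≤ τ)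
    (hcov : FamilyCover 𝓘 (24 / 5) (1 / 100) (1 / 8) τ) (hτs : 2 * τ < s₀) (hsep : HostSep 𝓘 s₀) (hr7 : r + 2 * τ ≤ 7)
    (hH : HostFarTabS 𝓘 τ r S Xh) (hE : ShellTail 𝓘 τ S Xe)
    (hdom : ∀ (M₀ : ℕ) (z₀ : Fin M₀ → E3) (c₀ h : Fin M₀), Xh M₀ z₀ c₀ h + Xe M₀ z₀ c₀ h ≤ X M₀ z₀ c₀ h)
    (h0 : HostTop 𝓘 τ bondD3 (cubicTail fun s => gammaMaj (s - 2 * τ)) r (k 0 * sigmaOne))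
    (hs : ∀ i : ℕ, i < n → HostStep 𝓘 τ sigmaOne bondD3 (cubicTail fun s => gammaMaj (s - 2 * τ)) r hessBlk0 force0 X (k i) (k (i + 1) * sigmaOne))
    (hcert : SlackCert 𝓘 τ (k n) sigmaOne hessBlk0 force0 X) : CoreOffTubeFloor (63 / 10) (63 / 10) (24 / 5) (1 / 100) 0 :=
  coreOff_of_envelope_hostTables k n hτ hcov hτs hsep (farColumn_mono hdom (farColumn_of_shellTabs hr7 hτ hH hE)) h0 hs hcert

/-! ## §4. RECOVERIES: the record of `…TailPacking` is the EMPTY selector; the packing discharge survives for every selector -/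

/-- (HFAR) ⟹ (HFAR-S) for a selector with vanishing shell constant (e.g. `emptySel`, `annulusSel w` with `w ≤ τ`). [formal bookkeeping] -/
theorem hostFarTabS_of_hostFarTab {𝓘 : ChartFam} {τ r : ℝ} {S : ShellSel} {Xh : SlackTab}
    (h0 : ∀ (M₀ : ℕ) (z₀ : Fin M₀ → E3) (c₀ h : Fin M₀), shellConst τ S z₀ c₀ h = 0) (hH : HostFarTab 𝓘 τ r Xh) : HostFarTabS 𝓘 τ r S Xh := by
  intro M₀ z₀ c₀ hI O D hR h hh hm
  rw [h0, sub_zero]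
  exact hH M₀ z₀ c₀ hI O D hR h hh hm

/-- (XTAIL) ⟹ (XTAIL-S) for a selector with vanishing shell constant. [formal bookkeeping] -/
theorem shellTail_of_extTail {𝓘 : ChartFam} {τ : ℝ} {S : ShellSel} {Xe : SlackTab}
    (h0 : ∀ (M₀ : ℕ) (z₀ : Fin M₀ → E3) (c₀ h : Fin M₀), shellConst τ S z₀ c₀ h = 0) (hE : ExtTail 𝓘 τ Xe) : ShellTail 𝓘 τ S Xe := by
  intro M z c M₀ z₀ c₀ e t hz hcl hm ht htT hch hf a ha hr
  rw [h0, sub_zero]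
  exact hE M z c M₀ z₀ c₀ e t hz hcl hm ht htT hch hf a ha hr

/-- (HFAR-S) ⟹ (HFAR) for a selector with vanishing shell constant: for such selectors the two host tables are the SAME statement. [formal bookkeeping] -/
theorem hostFarTab_of_hostFarTabS {𝓘 : ChartFam} {τ r : ℝ} {S : ShellSel} {Xh : SlackTab}
    (h0 : ∀ (M₀ : ℕ) (z₀ : Fin M₀ → E3) (c₀ h : Fin M₀), shellConst τ S z₀ c₀ h = 0) (hH : HostFarTabS 𝓘 τ r S Xh) : HostFarTab 𝓘 τ r Xh := by
  intro M₀ z₀ c₀ hI O D hR h hh hm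
  have h1 := hH M₀ z₀ c₀ hI O D hR h hh hm
  rwa [h0, sub_zero] at h1

/-- ★ THE PACKING DISCHARGE SURVIVES FOR EVERY SELECTOR: (XTAIL Xe) and a per-host-row bound `‖shellConst‖ ≤ Xs` give (XTAIL-S (Xe + Xs)) — so (XTAIL-S) is
never harder to certify than (XTAIL) (with `Xs` = the selected sum of `|V′|`, `norm_shellConst_le`, decidable per host row); the point of the split is that an
exterior chart can certify (XTAIL-S) with a column SMALLER than `Xe + Xs`. [formal bookkeeping] -/
theorem shellTail_of_extTail_add {𝓘 : ChartFam} {τ : ℝ} {S : ShellSel} {Xe Xs : SlackTab} (hE : ExtTail 𝓘 τ Xe)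
    (hS : ∀ (M₀ : ℕ) (z₀ : Fin M₀ → E3) (c₀ : Fin M₀), 𝓘 M₀ z₀ c₀ → ∀ h : Fin M₀, ‖shellConst τ S z₀ c₀ h‖ ≤ Xs M₀ z₀ c₀ h) :
    ShellTail 𝓘 τ S (fun M₀ z₀ c₀ h => Xe M₀ z₀ c₀ h + Xs M₀ z₀ c₀ h) := by
  intro M z c M₀ z₀ c₀ e t hz hcl hm ht htT hch hf a ha hr
  exact (norm_sub_le _ _).trans (add_le_add (hE M z c M₀ z₀ c₀ e t hz hcl hm ht htT hch hf a ha hr) (hS M₀ z₀ c₀ hch.1 (e a)))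

/-- (TAILCERT Xe) + the selected-constant bound ⟹ (XTAIL-S (Xe + Xs)). [formal bookkeeping: `extTail_of_tailCert` + `shellTail_of_extTail_add`] -/
theorem shellTail_of_tailCert_add {𝓘 : ChartFam} {τ : ℝ} {S : ShellSel} {Xe Xs : SlackTab} (hT : TailCert 𝓘 τ Xe)
    (hS : ∀ (M₀ : ℕ) (z₀ : Fin M₀ → E3) (c₀ : Fin M₀), 𝓘 M₀ z₀ c₀ → ∀ h : Fin M₀, ‖shellConst τ S z₀ c₀ h‖ ≤ Xs M₀ z₀ c₀ h) :
    ShellTail 𝓘 τ S (fun M₀ z₀ c₀ h => Xe M₀ z₀ c₀ h + Xs M₀ z₀ c₀ h) :=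
  shellTail_of_extTail_add (extTail_of_tailCert hT) hS

/-- ★ (R) RECOVERY OF THE RECORD `coreOff_of_envelope_tailCert` as the EMPTY-selector instance of `coreOff_of_envelope_shellTabs`. [formal bookkeeping] -/
theorem coreOff_of_envelope_tailCert_via_shell {𝓘 : ChartFam} {τ s₀ r : ℝ} {X Xh Xe : SlackTab} (k : ℕ → ℝ) (n : ℕ) (hτ : 0 ≤ τ)
    (hcov : FamilyCover 𝓘 (24 / 5) (1 / 100) (1 / 8) τ) (hτs : 2 * τ < s₀) (hsep : HostSep 𝓘 s₀) (hr7 : r + 2 * τ ≤ 7)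
    (hH : HostFarTab 𝓘 τ r Xh) (hT : TailCert 𝓘 τ Xe) (hdom : ∀ (M₀ : ℕ) (z₀ : Fin M₀ → E3) (c₀ h : Fin M₀), Xh M₀ z₀ c₀ h + Xe M₀ z₀ c₀ h ≤ X M₀ z₀ c₀ h)
    (h0 : HostTop 𝓘 τ bondD3 (cubicTail fun s => gammaMaj (s - 2 * τ)) r (k 0 * sigmaOne))
    (hs : ∀ i : ℕ, i < n → HostStep 𝓘 τ sigmaOne bondD3 (cubicTail fun s => gammaMaj (s - 2 * τ)) r hessBlk0 force0 X (k i) (k (i + 1) * sigmaOne))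
    (hcert : SlackCert 𝓘 τ (k n) sigmaOne hessBlk0 force0 X) : CoreOffTubeFloor (63 / 10) (63 / 10) (24 / 5) (1 / 100) 0 :=
  coreOff_of_envelope_shellTabs (S := emptySel) k n hτ hcov hτs hsep hr7 (hostFarTabS_of_hostFarTab (fun _ z₀ c₀ h => shellConst_emptySel τ z₀ c₀ h) hH)
    (shellTail_of_extTail (fun _ z₀ c₀ h => shellConst_emptySel τ z₀ c₀ h) (extTail_of_tailCert hT)) hdom h0 hs hcert

/-! ## §5. The typed ENTRY POINT of an exterior chart: the two-radius chart (SHELL-MATCH) with a host-side MATCHING-RADIUS TABLE -/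

/-- ★ **(SHELL-MATCH) `ShellMatch 𝓘 τ w R₁`** [cluster-quantified · the binders of (XTAIL); `R₁ : SlackTab` is a HOST-SIDE matching-radius table
(instance, centre, exterior host site `k₀` ↦ the radius within which the cluster partner matched to `k₀` is read).  At `w ≤ d₀/4` and
`R₁(k₀) = (1 + κ(k₀))·(1/8)·d₀⁺ + (1 + 2κ(k₀))·τ` (`κ(k₀)` = the host-computable transfer index of `k₀` from the interior neighbours of an interior anchor:
`1` for an fcc anchor whose antipodal member is charted, `≤ 2` for an fcc anchor with a charted triangular face, `≤ 3` for hcp anchors) it is the intended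
CONSEQUENCE of `CleanBall (63/10)` ∧ `ChartBy` (the pre-registered first-annulus matching lemma, generation 81); at `(w, R₁) = (7, d₀/8)` it is the NEW
conjunct under which the census column OCX8 certifies (XTAIL-S) — note `d₀/8 < (1/8)·d₀⁺ + 3τ`, below the intrinsic floor of any `CleanBall (1/8)`-based matching]:
the `τ`-chart `e` of the `63/10`-ball extends to a map `e'` charting every cluster site of the annulus `63/10 < dist ≤ 63/10 + w` with its offset read within
`R₁(e' k)`; `e'` is injective on the `(63/10 + w)`-ball; and every host site `k₀` with centre distance in `(63/10 + τ, 63/10 + w − R₁(k₀) − τ]` is the image of a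
cluster site of the `(63/10 + w)`-ball. -/
def ShellMatch (𝓘 : ChartFam) (τ w : ℝ) (R₁ : SlackTab) : Prop :=
  ∀ (M : ℕ) (z : Fin M → E3) (c : Fin M) (M₀ : ℕ) (z₀ : Fin M₀ → E3) (c₀ : Fin M₀) (e : Fin M → Fin M₀) (t : ℝ),
    Admissible M z c → CleanBall (63 / 10) z c → MonoPhaseBall (63 / 10) z c → 0 ≤ t → t ≤ constLaw τ M₀ z₀ c₀ → ChartBy 𝓘 τ t z c z₀ c₀ e →
      FineChart τ z c z₀ c₀ e →
        ∃ e' : Fin M → Fin M₀, (∀ a, dist (z a) (z c) ≤ 63 / 10 → e' a = e a) ∧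
          (∀ k, 63 / 10 < dist (z k) (z c) → dist (z k) (z c) ≤ 63 / 10 + w → dist (z k - z c) (z₀ (e' k) - z₀ c₀) ≤ R₁ M₀ z₀ c₀ (e' k)) ∧
          (∀ a b, dist (z a) (z c) ≤ 63 / 10 + w → dist (z b) (z c) ≤ 63 / 10 + w → e' a = e' b → a = b) ∧
          (∀ k₀, 63 / 10 + τ < dist (z₀ k₀) (z₀ c₀) → dist (z₀ k₀) (z₀ c₀) ≤ 63 / 10 + w - R₁ M₀ z₀ c₀ k₀ - τ →
            ∃ k, dist (z k) (z c) ≤ 63 / 10 + w ∧ e' k = k₀)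

/-- (SHELL-MATCH) is monotone in the matching-radius table (a coarser exterior chart is implied by a finer one). [formal bookkeeping] -/
theorem shellMatch_mono {𝓘 : ChartFam} {τ w : ℝ} {R₁ R₂ : SlackTab} (h12 : ∀ (M₀ : ℕ) (z₀ : Fin M₀ → E3) (c₀ k₀ : Fin M₀), R₁ M₀ z₀ c₀ k₀ ≤ R₂ M₀ z₀ c₀ k₀)
    (hM : ShellMatch 𝓘 τ w R₁) : ShellMatch 𝓘 τ w R₂ := by
  intro M z c M₀ z₀ c₀ e t hz hcl hm ht htT hch hf
  obtain ⟨e', hagree, hdev, hinj, hcov⟩ := hM M z c M₀ z₀ c₀ e t hz hcl hm ht htT hch hf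
  refine ⟨e', hagree, fun k hk1 hk2 => (hdev k hk1 hk2).trans (h12 M₀ z₀ c₀ (e' k)), hinj, fun k₀ h1 h2 => hcov k₀ h1 ?_⟩
  have h3 := h12 M₀ z₀ c₀ k₀
  linarith

/-- With an EMPTY annulus (`w ≤ 0`, `0 ≤ τ`, `0 ≤ R₁`) (SHELL-MATCH) holds with `e' := e`: the annulus clauses are vacuous and injectivity is the chart's.
[formal bookkeeping — the base of the exterior ladder] -/
theorem shellMatch_of_nonpos {𝓘 : ChartFam} {τ w : ℝ} {R₁ : SlackTab} (hw : w ≤ 0) (hτ : 0 ≤ τ)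
    (hr : ∀ (M₀ : ℕ) (z₀ : Fin M₀ → E3) (c₀ k₀ : Fin M₀), 0 ≤ R₁ M₀ z₀ c₀ k₀) : ShellMatch 𝓘 τ w R₁ := by
  intro M z c M₀ z₀ c₀ e t hz hcl hm ht htT hch hf
  refine ⟨e, fun a _ => rfl, fun k hk1 hk2 => absurd (hk1.trans_le hk2) (by linarith), fun a b ha hb hab => ?_, fun k₀ h1 h2 => ?_⟩
  · exact hch.2.2.2.2.1 a b (by linarith) (by linarith) hab
  · exfalso
    have h3 := hr M₀ z₀ c₀ k₀
    linarith

/-! ## §6. The records in GRADED table currency (the g77 / g78 junction with the shell split) -/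

section Graded

variable {𝓘 : ChartFam} {τ s₀ r : ℝ} {S : ShellSel} {T : SlackTab} {X Xh Xe : SlackTab} {Pm : PairMap}

/-- ★★★ **(TF-G) IN GRADED TABLE CURRENCY WITH THE SHELL SPLIT** — `TubeFloorG 𝓘 τ T` from: `2τ < s₀`, host separation, `r + 2τ ≤ 7`, (HFAR-S), (XTAIL-S), a
dominating column `X ≥ Xh + Xe`, an admissible pairing, the graded START table, `n` graded LP stages and the graded terminal certificate — LITERALLY
`tubeFloorG_of_envelope_tailCert_pairTabsG` with (HFAR, TAILCERT) replaced by (HFAR-S, XTAIL-S). [formal bookkeeping: `tubeFloorG_of_hostTabsG` + §3] -/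
theorem tubeFloorG_of_envelope_shellTabs_pairTabsG (P : ℕ → SlackTab) (n : ℕ) (hτ : 0 ≤ τ) (hτs : 2 * τ < s₀) (hsep : HostSep 𝓘 s₀)
    (hr7 : r + 2 * τ ≤ 7) (hH : HostFarTabS 𝓘 τ r S Xh) (hE : ShellTail 𝓘 τ S Xe)
    (hdom : ∀ (M₀ : ℕ) (z₀ : Fin M₀ → E3) (c₀ h : Fin M₀), Xh M₀ z₀ c₀ h + Xe M₀ z₀ c₀ h ≤ X M₀ z₀ c₀ h) (hPm : PairAdm r Pm)
    (h0 : DiffEvalTabG 𝓘 τ T bondD3 (cubicTail fun s => gammaMaj (s - 2 * τ)) r (boxTabG T) (P 0))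
    (hs : ∀ i : ℕ, i < n → StageCertG 𝓘 τ T sigmaOne bondD3 (cubicTail fun s => gammaMaj (s - 2 * τ)) r hessBlk0 force0 Pm (addCol X (P i)) (P (i + 1)))
    (hcert : SlackCertG 𝓘 τ T 0 sigmaOne hessBlk0 force0 (addCol X (P n))) : TubeFloorG 𝓘 τ T :=
  tubeFloorG_of_hostTabsG P n hτ (bondHessLip_env hτs) hsep (farColumn_mono hdom (farColumn_of_shellTabs hr7 hτ hH hE))
    (hostTopTabG_of_diffEvalTabG_box (tMono_cubicTail_gammaMaj τ) h0)
    (fun i hi => hostStepTabG_of_stageCertG bondD3_symm (tMono_cubicTail_gammaMaj τ) hPm (hs i hi)) hcert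

/-- ★★★ **THE T-LEAF RECORD IN GRADED TABLE CURRENCY WITH THE SHELL SPLIT** — `[CORE-FAR]` from the graded cover at `(τ, T)` and the data of
`tubeFloorG_of_envelope_shellTabs_pairTabsG`. [formal bookkeeping] -/
theorem coreOff_of_envelope_shellTabs_pairTabsG (P : ℕ → SlackTab) (n : ℕ) (hτ : 0 ≤ τ) (hcov : FamilyCoverG 𝓘 (24 / 5) (1 / 100) (1 / 8) τ T)
    (hτs : 2 * τ < s₀) (hsep : HostSep 𝓘 s₀) (hr7 : r + 2 * τ ≤ 7) (hH : HostFarTabS 𝓘 τ r S Xh) (hE : ShellTail 𝓘 τ S Xe)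
    (hdom : ∀ (M₀ : ℕ) (z₀ : Fin M₀ → E3) (c₀ h : Fin M₀), Xh M₀ z₀ c₀ h + Xe M₀ z₀ c₀ h ≤ X M₀ z₀ c₀ h) (hPm : PairAdm r Pm)
    (h0 : DiffEvalTabG 𝓘 τ T bondD3 (cubicTail fun s => gammaMaj (s - 2 * τ)) r (boxTabG T) (P 0))
    (hs : ∀ i : ℕ, i < n → StageCertG 𝓘 τ T sigmaOne bondD3 (cubicTail fun s => gammaMaj (s - 2 * τ)) r hessBlk0 force0 Pm (addCol X (P i)) (P (i + 1)))
    (hcert : SlackCertG 𝓘 τ T 0 sigmaOne hessBlk0 force0 (addCol X (P n))) : CoreOffTubeFloor (63 / 10) (63 / 10) (24 / 5) (1 / 100) 0 :=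
  coreOff_of_tubeFloorG_of_coverG_eighth (tubeFloorG_of_envelope_shellTabs_pairTabsG P n hτ hτs hsep hr7 hH hE hdom hPm h0 hs hcert) hcov

/-- ★★ **THE TWO-LEVEL INSTANCE AT THE SCALAR OF RECORD WITH THE SHELL SPLIT** — `τ = 1/100`, `T = gradeTol R_g τ_in (1/100)`; LITERALLY g78's
`coreOff_record_of_gradeTol_pairTabs` with (HFAR, TAILCERT) replaced by (HFAR-S, XTAIL-S) at exterior selector `S`. [formal bookkeeping] -/
theorem coreOff_record_of_gradeTol_shellTabs (Rg τin : ℝ) (P : ℕ → SlackTab) (n : ℕ)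
    (hcov : FamilyCoverG 𝓘 (24 / 5) (1 / 100) (1 / 8) (1 / 100) (gradeTol Rg τin (1 / 100))) (hτs : 2 * (1 / 100 : ℝ) < s₀) (hsep : HostSep 𝓘 s₀)
    (hr7 : r + 2 * (1 / 100 : ℝ) ≤ 7) (hH : HostFarTabS 𝓘 (1 / 100) r S Xh) (hE : ShellTail 𝓘 (1 / 100) S Xe)
    (hdom : ∀ (M₀ : ℕ) (z₀ : Fin M₀ → E3) (c₀ h : Fin M₀), Xh M₀ z₀ c₀ h + Xe M₀ z₀ c₀ h ≤ X M₀ z₀ c₀ h) (hPm : PairAdm r Pm)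
    (h0 : DiffEvalTabG 𝓘 (1 / 100) (gradeTol Rg τin (1 / 100)) bondD3 (cubicTail fun s => gammaMaj (s - 2 * (1 / 100))) r
      (boxTabG (gradeTol Rg τin (1 / 100))) (P 0))
    (hs : ∀ i : ℕ, i < n → StageCertG 𝓘 (1 / 100) (gradeTol Rg τin (1 / 100)) sigmaOne bondD3 (cubicTail fun s => gammaMaj (s - 2 * (1 / 100))) r
      hessBlk0 force0 Pm (addCol X (P i)) (P (i + 1)))
    (hcert : SlackCertG 𝓘 (1 / 100) (gradeTol Rg τin (1 / 100)) 0 sigmaOne hessBlk0 force0 (addCol X (P n))) :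
    CoreOffTubeFloor (63 / 10) (63 / 10) (24 / 5) (1 / 100) 0 :=
  coreOff_of_envelope_shellTabs_pairTabsG P n (by norm_num) hcov hτs hsep hr7 hH hE hdom hPm h0 hs hcert

/-- (R-G) RECOVERY of g78's `coreOff_record_of_gradeTol_pairTabs` as the EMPTY-selector instance. [formal bookkeeping] -/
theorem coreOff_record_of_gradeTol_pairTabs_via_shell (Rg τin : ℝ) (P : ℕ → SlackTab) (n : ℕ)
    (hcov : FamilyCoverG 𝓘 (24 / 5) (1 / 100) (1 / 8) (1 / 100) (gradeTol Rg τin (1 / 100))) (hτs : 2 * (1 / 100 : ℝ) < s₀) (hsep : HostSep 𝓘 s₀)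
    (hr7 : r + 2 * (1 / 100 : ℝ) ≤ 7) (hH : HostFarTab 𝓘 (1 / 100) r Xh) (hTl : TailCert 𝓘 (1 / 100) Xe)
    (hdom : ∀ (M₀ : ℕ) (z₀ : Fin M₀ → E3) (c₀ h : Fin M₀), Xh M₀ z₀ c₀ h + Xe M₀ z₀ c₀ h ≤ X M₀ z₀ c₀ h) (hPm : PairAdm r Pm)
    (h0 : DiffEvalTabG 𝓘 (1 / 100) (gradeTol Rg τin (1 / 100)) bondD3 (cubicTail fun s => gammaMaj (s - 2 * (1 / 100))) r
      (boxTabG (gradeTol Rg τin (1 / 100))) (P 0))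
    (hs : ∀ i : ℕ, i < n → StageCertG 𝓘 (1 / 100) (gradeTol Rg τin (1 / 100)) sigmaOne bondD3 (cubicTail fun s => gammaMaj (s - 2 * (1 / 100))) r
      hessBlk0 force0 Pm (addCol X (P i)) (P (i + 1)))
    (hcert : SlackCertG 𝓘 (1 / 100) (gradeTol Rg τin (1 / 100)) 0 sigmaOne hessBlk0 force0 (addCol X (P n))) :
    CoreOffTubeFloor (63 / 10) (63 / 10) (24 / 5) (1 / 100) 0 :=
  coreOff_record_of_gradeTol_shellTabs (S := emptySel) Rg τin P n hcov hτs hsep hr7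
    (hostFarTabS_of_hostFarTab (fun _ z₀ c₀ h => shellConst_emptySel (1 / 100) z₀ c₀ h) hH)
    (shellTail_of_extTail (fun _ z₀ c₀ h => shellConst_emptySel (1 / 100) z₀ c₀ h) (extTail_of_tailCert hTl)) hdom hPm h0 hs hcert

end Graded

end Summit.AtomisticToContinuum.Crystallization.Theorems.FrustratedLawDichotomyStrainedPatchShellSplit
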